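import Mathlib
import Literature.Computability.Complexity.CNF
import Literature.Computability.Complexity.CoinCounting
import Literature.Computability.Complexity.ApproximateCounting
import Literature.Computability.Complexity.CHSums
import Literature.Computability.Complexity.UniformDerandomizationSelectByTesting
import Literature.Computability.Complexity.CountingHierarchyProofs
import Literature.Computability.Complexity.BPExpOperator
import Literature.Computability.Complexity.BPPErrorReduction
import Summits.PneNP.PneNP.Theses.WitnessForging
import Summits.PneNP.PneNP.Theorems.WitnessForgingSatBridgeDefs
import Summits.PneNP.PneNP.Theorems.WitnessForgingSatBridgeCoin

/-!
# Route WitnessForging — support item `SatBridge` (stmt-PneNP-2432), part 4b: all rounds, the product bound, total variation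

Continuation of `WitnessForgingSatBridgeCoin.lean`: the rounds of the JVV sampler on consecutive
fresh coin blocks multiply their success probabilities (`rounds_prob_ge`, fibrewise induction;
`chunks_cons`, `chunks_take`); two estimators agreeing on short prefixes drive the same run
(`foldl_stepJVV_congr`); the real arithmetic of the product of the per-round bounds
(`step_bound_ge`, `prod_ratio_telescope`, `prod_lower` — Bernoulli); and the passage from a
one-sided pointwise bound `P(y) ≥ (1-δ)/#S` to the total-variation bound `|Pr[E] - #(S∩E)/#S| ≤ δ`
(`tv_of_pointwise`, via `uniformProb_preimage_eq_sum`).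
-/

set_option linter.dupNamespace false -- `Summit.PneNP.PneNP.…`: summit = sub-problem (D-0017)

namespace Summit.PneNP.PneNP.Theorems.SatBridgeJVV

open Literature.Computability.Complexity
open _root_.Computability Finset

/-! ### All rounds -/

/-- The coin blocks of a string: `m` consecutive blocks of length `Bk`. [folklore] -/
theorem chunks_cons (Bk m : ℕ) (blk β : List Bool) (hblk : blk.length = Bk) :
    ((List.range (m + 1)).map fun i => ((blk ++ β).drop (i * Bk)).take Bk) =
      blk :: (List.range m).map fun i => (β.drop (i * Bk)).take Bk := by
  rw [List.range_succ_eq_map, List.map_cons, List.map_map]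
  congr 1
  · rw [Nat.zero_mul, List.drop_zero, List.take_append_of_le_length hblk.ge, ← hblk, List.take_length]
  · apply List.map_congr_left
    intro i _
    simp only [Function.comp_apply]
    rw [Nat.succ_mul, Nat.add_comm, ← List.drop_drop, ← hblk, List.drop_left]

/-- **All rounds.** If round `j` (from the prefix `y ↾ j`) produces `y ↾ (j+1)` with probability
`≥ B j ≥ 0` on a fresh block, then `m` rounds from `y ↾ i` on `m` fresh blocks (followed by `extra`
unused coins) produce `y ↾ (i+m)` with probability `≥ ∏_{j ∈ [i, i+m)} B j`.
[cite: JerrumValiantVazirani1986, §3] -/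
theorem rounds_prob_ge (est : List Bool → Bool → List Bool → ℕ) (U L : ℕ) (y : List Bool)
    (B : ℕ → ℝ) (hB0 : ∀ j, 0 ≤ B j)
    (hB : ∀ j, B j ≤ uniformProb (2 * U + L) {blk | stepJVV est U L (y.take j) blk = y.take (j + 1)})
    (extra : ℕ) :
    ∀ (m i : ℕ), ∏ j ∈ Finset.range m, B (i + j) ≤
      uniformProb (m * (2 * U + L) + extra) {β | ((List.range m).map fun i =>
        (β.drop (i * (2 * U + L))).take (2 * U + L)).foldl (stepJVV est U L) (y.take i) = y.take (i + m)}
  | 0, i => by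
    rw [Finset.prod_range_zero, Nat.zero_mul, Nat.zero_add]
    refine le_of_eq ?_
    rw [uniformProb_eq_cnt_div, eq_div_iff (by positivity), one_mul]
    have : cnt extra {β : List Bool | ((List.range 0).map fun i => (β.drop (i * (2 * U + L))).take
        (2 * U + L)).foldl (stepJVV est U L) (y.take i) = y.take (i + 0)} = 2 ^ extra :=
      cnt_eq_two_pow_of_forall fun β _ => by simp
    exact_mod_cast this.symm
  | m + 1, i => by
    rw [show (m + 1) * (2 * U + L) + extra = (2 * U + L) + (m * (2 * U + L) + extra) by ring]
    have ih := rounds_prob_ge est U L y B hB0 hB extra m (i + 1)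
    have hfib : ∀ blk : List Bool, blk.length = 2 * U + L →
        blk ∈ {blk | stepJVV est U L (y.take i) blk = y.take (i + 1)} →
        ∏ j ∈ Finset.range m, B (i + 1 + j) ≤ uniformProb (m * (2 * U + L) + extra)
          {β | blk ++ β ∈ {β : List Bool | ((List.range (m + 1)).map fun i =>
            (β.drop (i * (2 * U + L))).take (2 * U + L)).foldl (stepJVV est U L) (y.take i) =
              y.take (i + (m + 1))}} := by
      intro blk hblk hstep
      refine ih.trans (BPExp.uniformProb_mono_len fun β hβ _ => ?_)
      simp only [Set.mem_setOf_eq] at hstep hβ ⊢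
      rw [chunks_cons _ _ _ _ hblk, List.foldl_cons, hstep, hβ]
      ring_nf
    have hprod : ∏ j ∈ Finset.range (m + 1), B (i + j) = B i * ∏ j ∈ Finset.range m, B (i + 1 + j) := by
      rw [Finset.prod_range_succ', mul_comm, Nat.add_zero]
      congr 1
      exact Finset.prod_congr rfl fun j _ => by rw [show i + (j + 1) = i + 1 + j by omega]
    rw [hprod]
    calc B i * ∏ j ∈ Finset.range m, B (i + 1 + j)
        ≤ uniformProb (2 * U + L) {blk | stepJVV est U L (y.take i) blk = y.take (i + 1)} *
            ∏ j ∈ Finset.range m, B (i + 1 + j) :=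
          mul_le_mul_of_nonneg_right (hB i) (Finset.prod_nonneg fun j _ => hB0 _)
      _ ≤ _ := le_uniformProb_add_of_fibre hfib

/-- The first `n` blocks of `N ≥ n` blocks are the `n` blocks. [folklore] -/
theorem chunks_take (Bk N n : ℕ) (hn : n ≤ N) (β : List Bool) :
    ((List.range N).map fun i => (β.drop (i * Bk)).take Bk).take n =
      (List.range n).map fun i => (β.drop (i * Bk)).take Bk := by
  rw [← List.map_take, List.take_range, min_eq_left hn]

/-- **Two estimators that agree on short prefixes drive the same run.** [folklore] -/
theorem foldl_stepJVV_congr {est₁ est₂ : List Bool → Bool → List Bool → ℕ} {U L n : ℕ}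
    (h : ∀ (w : List Bool) (b : Bool) (u : List Bool), w.length < n → est₁ w b u = est₂ w b u) :
    ∀ (l : List (List Bool)) (acc : List Bool), acc.length + l.length ≤ n →
      l.foldl (stepJVV est₁ U L) acc = l.foldl (stepJVV est₂ U L) acc
  | [], _, _ => rfl
  | blk :: l, acc, hlen => by
    rw [List.foldl_cons, List.foldl_cons]
    have hacc : acc.length < n := by simp at hlen; omega
    have hstep : stepJVV est₁ U L acc blk = stepJVV est₂ U L acc blk := by
      simp only [stepJVV, h acc _ _ hacc]
    rw [hstep]
    refine foldl_stepJVV_congr h l _ ?_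
    simp only [stepJVV, List.length_append, List.length_cons, List.length_nil] at hlen ⊢
    omega

/-! ### Real arithmetic of the product bound -/

/-- **The per-round bound in product form**: with `a = 1/k`, `t = 2^{-L} ≤ p·e` and `4a + e ≤ 1`,
`p · (1 - 4a - e) ≤ (1-a)·((1-a)·(p/(1+a)² - t))`. [folklore] -/
theorem step_bound_ge {a e p t : ℝ} (ha : 0 ≤ a) (he : 0 ≤ e) (hp : 0 ≤ p) (ht : t ≤ p * e)
    (hx : 4 * a + e ≤ 1) : p * (1 - 4 * a - e) ≤ (1 - a) * ((1 - a) * (p / (1 + a) ^ 2 - t)) := by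
  have h1a : 0 < (1 + a) ^ 2 := by positivity
  -- `1/(1+a)² ≥ 1 - 2a`
  have hinv : p * (1 - 2 * a) ≤ p / (1 + a) ^ 2 := by
    rw [le_div_iff₀ h1a]
    have : (1 - 2 * a) * (1 + a) ^ 2 ≤ 1 := by nlinarith [sq_nonneg a, mul_nonneg ha (sq_nonneg a)]
    nlinarith
  have hX : p * (1 - 2 * a - e) ≤ p / (1 + a) ^ 2 - t := by nlinarith
  have hpos : 0 ≤ 1 - 2 * a - e := by linarith
  have hsq : 1 - 2 * a ≤ (1 - a) * (1 - a) := by nlinarith [sq_nonneg a]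
  calc p * (1 - 4 * a - e) ≤ (1 - 2 * a) * (p * (1 - 2 * a - e)) := by nlinarith [mul_nonneg hp hpos, mul_nonneg ha he]
    _ ≤ ((1 - a) * (1 - a)) * (p * (1 - 2 * a - e)) :=
        mul_le_mul_of_nonneg_right hsq (mul_nonneg hp hpos)
    _ ≤ ((1 - a) * (1 - a)) * (p / (1 + a) ^ 2 - t) :=
        mul_le_mul_of_nonneg_left hX (mul_self_nonneg _)
    _ = (1 - a) * ((1 - a) * (p / (1 + a) ^ 2 - t)) := by ring

/-- **Telescoping**: `∏_{j<m} e(j+1)/e(j) = e(m)/e(0)` for nonvanishing `e`. [folklore] -/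
theorem prod_ratio_telescope (e : ℕ → ℝ) (he : ∀ j, e j ≠ 0) :
    ∀ m : ℕ, ∏ j ∈ Finset.range m, e (j + 1) / e j = e m / e 0
  | 0 => by simp [he 0]
  | m + 1 => by
    rw [Finset.prod_range_succ, prod_ratio_telescope e he m]
    field_simp [he 0, he m]

/-- **The product bound**: if `B j ≥ p j · (1 - x)` with `p j ≥ 0` and `0 ≤ x ≤ 1`, then
`∏_{j<n} B j ≥ (∏_{j<n} p j) · (1 - n·x)` (Bernoulli's inequality; `x ≤ 1`). [folklore] -/
theorem prod_lower (n : ℕ) (p B : ℕ → ℝ) (x : ℝ) (hx1 : x ≤ 1) (hp : ∀ j, 0 ≤ p j)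
    (hB : ∀ j < n, p j * (1 - x) ≤ B j) :
    (∏ j ∈ Finset.range n, p j) * (1 - n * x) ≤ ∏ j ∈ Finset.range n, B j := by
  have hbern : 1 - (n : ℝ) * x ≤ (1 - x) ^ n := by
    have := one_add_mul_le_pow (a := -x) (by linarith) n
    simpa [sub_eq_add_neg] using this
  have hprod : 0 ≤ ∏ j ∈ Finset.range n, p j := Finset.prod_nonneg fun j _ => hp j
  calc (∏ j ∈ Finset.range n, p j) * (1 - n * x) ≤ (∏ j ∈ Finset.range n, p j) * (1 - x) ^ n :=
        mul_le_mul_of_nonneg_left hbern hprod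
    _ = ∏ j ∈ Finset.range n, p j * (1 - x) := by
        rw [Finset.prod_mul_distrib, Finset.prod_const, Finset.card_range]
    _ ≤ ∏ j ∈ Finset.range n, B j :=
        Finset.prod_le_prod (fun j _ => mul_nonneg (hp j) (by linarith)) fun j hj =>
          hB j (Finset.mem_range.1 hj)

/-! ### From pointwise lower bounds to total variation -/

/-- The probability of hitting a finite set of values is the sum over the values. [folklore] -/
theorem uniformProb_preimage_eq_sum (m : ℕ) (out : List Bool → List Bool) (T : Finset (List Bool)) :
    uniformProb m {ω | out ω ∈ (T : Set (List Bool))} = ∑ y ∈ T, uniformProb m {ω | out ω = y} := by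
  classical
  simp only [uniformProb_eq_cnt_div]
  rw [← Finset.sum_div]
  congr 1
  have h := cnt_preimage_eq_sum m out T
  have hset : {ω : List Bool | out ω ∈ (T : Set (List Bool))} = {ω | out ω ∈ T} := by ext; simp
  rw [hset, h]
  push_cast
  rfl

/-- **One-sided pointwise bounds give the total-variation bound.** If a random string `out ω`
(`ω` uniform of length `m`) hits every point `y` of a nonempty finite set `S` with probability
`≥ (1-δ)/#S`, `δ ≥ 0`, then for EVERY event `E`, `|Pr[out ∈ E] - #(S ∩ E)/#S| ≤ δ` (the lower bound
summed over `S ∩ E`, and over `S ∩ Eᶜ` for the upper bound, the total mass being `1`). [folklore] -/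
theorem tv_of_pointwise {m : ℕ} (out : List Bool → List Bool) (S : Finset (List Bool)) (hS : S.Nonempty)
    {δ : ℝ} (hδ : 0 ≤ δ) (h : ∀ y ∈ S, (1 - δ) / S.card ≤ uniformProb m {ω | out ω = y})
    (E : Set (List Bool)) [DecidablePred (· ∈ E)] :
    |uniformProb m {ω | out ω ∈ E} - ((S.filter (· ∈ E)).card : ℝ) / S.card| ≤ δ := by
  classical
  have hcard : (0 : ℝ) < S.card := by exact_mod_cast hS.card_pos
  -- the lower bound, for an arbitrary event
  have lower : ∀ (F : Set (List Bool)) [DecidablePred (· ∈ F)],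
      ((S.filter (· ∈ F)).card : ℝ) / S.card - δ ≤ uniformProb m {ω | out ω ∈ F} := by
    intro F _
    have hsub : uniformProb m {ω | out ω ∈ ((S.filter (· ∈ F) : Finset (List Bool)) : Set (List Bool))} ≤
        uniformProb m {ω | out ω ∈ F} :=
      BPExp.uniformProb_mono_len fun ω hω _ => by
        simp only [Set.mem_setOf_eq, Finset.coe_filter] at hω ⊢
        exact hω.2
    refine le_trans ?_ hsub
    rw [uniformProb_preimage_eq_sum]
    have hle : ((S.filter (· ∈ F)).card : ℝ) ≤ S.card := by exact_mod_cast Finset.card_filter_le _ _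
    have hratio : ((S.filter (· ∈ F)).card : ℝ) / S.card ≤ 1 := by rwa [div_le_one hcard]
    have hratio0 : (0 : ℝ) ≤ ((S.filter (· ∈ F)).card : ℝ) / S.card := by positivity
    calc ((S.filter (· ∈ F)).card : ℝ) / S.card - δ
        ≤ ((S.filter (· ∈ F)).card : ℝ) * ((1 - δ) / S.card) := by
          have : ((S.filter (· ∈ F)).card : ℝ) * ((1 - δ) / S.card) =
              (S.filter (· ∈ F)).card / S.card - δ * ((S.filter (· ∈ F)).card / S.card) := by ring
          rw [this]
          nlinarith
      _ = ∑ y ∈ S.filter (· ∈ F), (1 - δ) / S.card := by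
          rw [Finset.sum_const, nsmul_eq_mul]
      _ ≤ ∑ y ∈ S.filter (· ∈ F), uniformProb m {ω | out ω = y} :=
          Finset.sum_le_sum fun y hy => h y (Finset.mem_filter.1 hy).1
  rw [abs_le]
  constructor
  · linarith [lower E]
  · -- the upper bound from the lower bound of the complement
    have hc := lower Eᶜ
    have hcompl : uniformProb m {ω | out ω ∈ E} = 1 - uniformProb m {ω | out ω ∈ Eᶜ} := by
      rw [← uniformProb_compl]; congr 1; ext ω; simp
    have hcardc : ((S.filter (· ∈ Eᶜ)).card : ℝ) = S.card - (S.filter (· ∈ E)).card := by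
      have h1 := Finset.card_filter_add_card_filter_not (s := S) (fun y => y ∈ E)
      have h2 : (S.filter (· ∈ Eᶜ)) = S.filter (fun y => ¬ y ∈ E) := by
        ext y; simp
      rw [h2]
      have h3 : ((S.filter (fun y => y ∈ E)).card : ℝ) + ((S.filter (fun y => ¬ y ∈ E)).card : ℝ) = S.card := by
        exact_mod_cast h1
      linarith
    rw [hcardc] at hc
    rw [hcompl]
    rw [sub_div, div_self hcard.ne'] at hc
    linarith


end Summit.PneNP.PneNP.Theorems.SatBridgeJVV
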